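import Summits.QuantumFields.YangMills.Theorems.BalabanUVNodesN19UniformMomentPriceTwoSided
import Summits.QuantumFields.YangMills.Theorems.BalabanUVNodesN19ChebyshevArcLaws
import Summits.QuantumFields.YangMills.Theorems.BalabanUVNodesN19ExpectationCurrencyTwoConstantsAtScheme

/-!
# YM-DAG node N19 (= NE7 proper) — THE LAW-SUMMABILITY THRESHOLD OF THE UNIFORM-MOMENT CURRENCY, I:
# the rate `1∕(1 + log⁺ r⁻¹)`, the upper half, and ONE BASE FOR EVERY LEVEL (the complementary Chebyshev-arc laws at half scale)

Cell `pub-ymgap`, HUMAN RULING D-0062 (Track A) ∕ D-0149 (work-bound push), R141 (C) wider-strategy seat `pub-ymgap-dag-n19-e` (strategy s3 =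
ALTERNATIVE CURRENCY), generation g23, module 1 (lineage module 78).  Route `Summits/QuantumFields/YangMills/Theses/BalabanUVNodes.lean` rev 25,
cluster item K3⁷ «SpineGivenEndpointR13SepCoPH» (stmt-QuantumFields-20544); filed `--supports` that item `--as helper` (it proves no registered
stub).  COUNT-NEUTRAL: [folklore] over Mathlib (`Real.posLog`, `Measure.map`, `Polynomial.Chebyshev.node`) + the lineage BY NAME — p579777
`…N19UniformMomentPriceTwoSided` (`law_price_le_of_uniformMoments`), p555512 `…N19LawPriceTwoSided` (`abs_integral_le_of_Icc_symm`), modules 71 ∕ 72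
`…N19ChebyshevArcFunctional` ∕ `…N19ChebyshevArcLaws` (the arcs, `alt_sum_integral_pow_eq_zero`, the test polynomial), p481156
`…N19ExpectationCurrencyTwoConstantsAtScheme` (`abs_expectAt_succ_sub_le_linlog_of_matchingModConstants`), `T4GenFunConverse.prodObs_replicate_flatten`,
module 64 `law_prodObs_Icc_compl`; `MatchingModConstants` ∕ `Spine.NE7.Target` (N19's DECL-target SHAPE) enter only as HYPOTHESES of §3; NOT a discharge claim.

THE QUESTION (HANDOFF v19 ∕ CURRENCY-MAP v1, open item «uniform-target threshold»).  Modules 74–77 settled WHEN N19's window currency (cgf increments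
on `|t| ≤ l₀` modulo constants, remainder `vol·δ_K`) controls the bounded-Lipschitz increments of the string laws SUMMABLY: iff `Σ_K log(e+L_K)∕(1+L_K) < ∞`
for antitone remainders (`L_K = log⁺(vol·δ_K)⁻¹`).  The UNIFORM-MOMENT currency — ALL moments `r`-close, the currency of UNIFORM `Target` (every string at
once), priced `Θ(1∕log r⁻¹)` per step WITHOUT the window's `log log` (p579777) — asks the same question.  THIS FILE gives the rate, the upper half and
the base family; the sibling `…UniformMomentSummabilityThresholdSharp` gives the lower half and the iff.

§1 ★ `lawIncrement_le_of_uniformMoments` — EVERY REAL `r`: probability laws `μ, ν` on `[−1,1]` with `|∫x^j dν − ∫x^j dμ| ≤ r` for every `j`, a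
continuous `g`, `K`-Lipschitz and `G`-bounded on `[−1,1]` ⇒ `|∫g dν − ∫g dμ| ≤ 48(K+G)∕(1 + log⁺ r⁻¹)` (p579777 for `0 < r ≤ 1`; `r = 0` or `r > 1`:
`log⁺ r⁻¹ = 0` and the trivial `2G`; `r < 0` is empty); ★★ `summable_lawIncrements_of_uniformMoments`: laws `λ_K` on `[−1,1]` with
`|∫x^j dλ_{K+1} − ∫x^j dλ_K| ≤ r_K` (all `j`) and `Σ_K 1∕(1 + log⁺ r_K⁻¹) < ∞` have summable increments along every uniformly Lipschitz ∕ bounded test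
sequence.  §2 THE BASE FAMILY (what HANDOFF v19 called «uniform-moment witnesses with a common base», found in the tree): ★
`exists_chebyshevArc_laws_alt` re-packages module 72's complementary Chebyshev-arc laws `P_n, Q_n` with their two STRUCTURAL identities
`∫f dP − ∫f dQ = Σ_{k<n}(−1)^k∫_{x_{k+1}}^{x_k} f` and `∫f dP + ∫f dQ = ∫_{−1}^{1} f`; ★★ `exists_halfScale_chebyshevArc_laws` transports them by `x ↦ x∕2`
(`Measure.map`): the moments of order `j ≤ n−2` EQUAL `β_j = ½∫_{−1}^{1}(x∕2)^j dx` (module 71: the alternating arc functional kills `x^j`), the moments of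
order `j ≥ n−1` are within `½·2·(½)^j ≤ 2(½)^n` of `β_j` trivially (`|x∕2| ≤ ½` on the arcs) — so ALL moments of BOTH laws are within `2(½)^n` of ONE
sequence `β` that does not depend on `n` — while module 72's test polynomial pulled back along the clamp of `2y` is continuous, `1`-Lipschitz,
`1∕(4n)`-bounded on `[−1,1]` and paid `∫g dP'_n − ∫g dQ'_n = 1∕(4n)` EXACTLY.  §3 AT THE SCHEME [bookkeeping]: under matching modulo constants for EVERY
power of one string (`∀ k, MatchingModConstants vol l₀ δ (schemeZ S os^k)`, `os^k` the `k`-fold concatenation — in particular under uniform `Target`),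
the `k`-th moments of the laws of `∏os` move by at most p481156's one-step price `r_K = (8e^{1+l₀}∕l₀)·vol·δ_K·(1 + log⁺(2vol·δ_K)⁻¹)` UNIFORMLY IN `k`
(`uniformMoments_step_of_matchingModConstants_pow`), hence ★ `summable_lawIncrements_of_matchingModConstants_pow` ∕ ★ `…_of_uniformTarget`: the
law increments of `∏os` are summable as soon as `Σ_K 1∕(1 + log⁺ r_K⁻¹) < ∞` — the window's `log log` is gone (compare module 74's
`summable_lawIncrements_of_target`, which needs `Σ log(e+L_K)∕(1+L_K) < ∞`).

HONEST FRAMING (binding).  Elementary and [folklore]; TOY laws ∕ the scheme under HYPOTHESES; NO consumer in the DAG today; nothing of Bałaban's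
instantiated; NE7 NOT PRINTED, NOT proved; N19 NOT discharged; count-neutral.  One finite `T⁴` at fixed `ε`; nothing continuum ∕ `ℝ⁴` ∕ OS ∕ mass-gap ∕ Clay.
-/

noncomputable section

open Real Finset MeasureTheory ProbabilityTheory Polynomial Polynomial.Chebyshev

namespace Summit.QuantumFields.YangMills.Theorems.BalabanUVNodesN19UniformMomentSummabilityThreshold

open Literature.MathematicalPhysics.QuantumFieldTheory.Balaban1983to89
open T4GenFunBounds (prodObs gibbsMeasure schemeZ)
open T4GenFunConverse (prodObs_replicate_flatten)
open T4CauchySum (MatchingModConstants)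
open Missing (TorusScheme)
open Summit.QuantumFields.BalabanUV.T4Continuum.Spine
open Summit.QuantumFields.YangMills.Theorems.BalabanUVNodesN19UniformMomentPriceTwoSided (law_price_le_of_uniformMoments)
open Summit.QuantumFields.YangMills.Theorems.BalabanUVNodesN19LawPriceTwoSided (abs_integral_le_of_Icc_symm)
open Summit.QuantumFields.YangMills.Theorems.BalabanUVNodesN19ChebyshevArcFunctional
  (node_succ_lt sum_arcLength sum_arcLength_even_odd alt_sum_integral_pow_eq_zero)
open Summit.QuantumFields.YangMills.Theorems.BalabanUVNodesN19ChebyshevArcLaws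
  (arcMeasure_apply_univ arcMeasure_Icc_compl integral_arcMeasure alt_sum_eq_even_sub_odd sum_integral_arcs
    testPoly_lipschitz_bound alt_sum_integral_testPoly)
open Summit.QuantumFields.YangMills.BalabanUVNodes.N19ExpectationCurrencyTwoConstantsAtScheme
  (abs_expectAt_succ_sub_le_linlog_of_matchingModConstants)
open Summit.QuantumFields.YangMills.Theorems.BalabanUVNodesN19LawIncrementsTarget (law_prodObs_Icc_compl)

/-! ## §1 The rate `1∕(1 + log⁺ r⁻¹)` and the upper half [folklore] -/

/-- The rate is positive. [folklore] -/
theorem invLogRate_pos (x : ℝ) : 0 < 1 / (1 + Real.posLog x⁻¹) := by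
  have h := Real.posLog_nonneg (x := x⁻¹)
  positivity

/-- The rate is at most `1`. [folklore] -/
theorem invLogRate_le_one (x : ℝ) : 1 / (1 + Real.posLog x⁻¹) ≤ 1 := by
  have h := Real.posLog_nonneg (x := x⁻¹)
  rw [div_le_one (by linarith)]
  linarith

/-- The rate is monotone in the closeness parameter: `0 < x ≤ y ⇒ 1∕(1 + log⁺ x⁻¹) ≤ 1∕(1 + log⁺ y⁻¹)`. [folklore] -/
theorem invLogRate_posLog_inv_mono {x y : ℝ} (hx : 0 < x) (hxy : x ≤ y) :
    1 / (1 + Real.posLog x⁻¹) ≤ 1 / (1 + Real.posLog y⁻¹) := by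
  have h : Real.posLog y⁻¹ ≤ Real.posLog x⁻¹ :=
    Real.posLog_le_posLog (inv_nonneg.2 (hx.le.trans hxy)) (inv_anti₀ hx hxy)
  have hy := Real.posLog_nonneg (x := y⁻¹)
  exact one_div_le_one_div_of_le (by linarith) (by linarith)

section Laws

variable {μ ν : Measure ℝ} [IsProbabilityMeasure μ] [IsProbabilityMeasure ν]

/-- ★ **THE PER-STEP PRICE OF UNIFORM MOMENT CLOSENESS, EVERY REAL `r`.**  Probability laws `μ, ν` on `[−1,1]` with `|∫x^j dν − ∫x^j dμ| ≤ r` for every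
`j`; `g` continuous, `K`-Lipschitz and `G`-bounded on `[−1,1]` (`0 ≤ K`).  Then `|∫g dν − ∫g dμ| ≤ 48(K+G)∕(1 + log⁺ r⁻¹)` — p579777
`law_price_le_of_uniformMoments` for `0 < r ≤ 1`; for `r = 0` or `r > 1` the rate is `1` and the bound is the trivial `2G`; `r < 0` is empty. [folklore] -/
theorem lawIncrement_le_of_uniformMoments (hμ : μ (Set.Icc (-1 : ℝ) 1)ᶜ = 0) (hν : ν (Set.Icc (-1 : ℝ) 1)ᶜ = 0)
    {r : ℝ} (hmom : ∀ j : ℕ, |∫ x, x ^ j ∂ν - ∫ x, x ^ j ∂μ| ≤ r)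
    {g : ℝ → ℝ} (hg : Continuous g) {K G : ℝ} (hK0 : 0 ≤ K)
    (hK : ∀ x y : ℝ, x ∈ Set.Icc (-1 : ℝ) 1 → y ∈ Set.Icc (-1 : ℝ) 1 → |g x - g y| ≤ K * |x - y|)
    (hG : ∀ x : ℝ, x ∈ Set.Icc (-1 : ℝ) 1 → |g x| ≤ G) :
    |∫ x, g x ∂ν - ∫ x, g x ∂μ| ≤ 48 * (K + G) / (1 + Real.posLog r⁻¹) := by
  by_cases hr : 0 < r ∧ r ≤ 1
  · have hlog : Real.posLog r⁻¹ = Real.log r⁻¹ :=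
      Real.posLog_eq_log (by rw [abs_of_pos (inv_pos.2 hr.1)]; exact (one_le_inv₀ hr.1).2 hr.2)
    rw [hlog]
    exact law_price_le_of_uniformMoments hμ hν hr.1 hr.2 hmom hg hK0 hK hG
  · have hG0 : 0 ≤ G := (abs_nonneg _).trans (hG 0 ⟨by norm_num, by norm_num⟩)
    have hrnn : 0 ≤ r := (abs_nonneg _).trans (hmom 0)
    have hpos : Real.posLog r⁻¹ = 0 := by
      rw [Real.posLog_eq_zero_iff]
      rcases le_or_gt r 1 with h | h
      · have h0 : r = 0 := by
          by_contra hne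
          exact hr ⟨lt_of_le_of_ne hrnn (Ne.symm hne), h⟩
        rw [h0, inv_zero, abs_zero]
        exact zero_le_one
      · rw [abs_of_pos (inv_pos.2 (by linarith))]
        exact inv_le_one_of_one_le₀ h.le
    rw [hpos, add_zero, div_one]
    calc |∫ x, g x ∂ν - ∫ x, g x ∂μ| ≤ |∫ x, g x ∂ν| + |∫ x, g x ∂μ| := abs_sub _ _
      _ ≤ G + G := add_le_add (abs_integral_le_of_Icc_symm hν hG) (abs_integral_le_of_Icc_symm hμ hG)
      _ ≤ 48 * (K + G) := by nlinarith

/-- ★★ **THE UPPER HALF OF THE THRESHOLD (uniform-moment currency).**  Probability laws `λ_K` on `[−1,1]` whose moments move by at most `r_K` at step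
`K`, UNIFORMLY IN THE ORDER: IF `Σ_K 1∕(1 + log⁺ r_K⁻¹) < ∞` THEN along every test sequence `g_K` (continuous, uniformly `K_g`-Lipschitz and
`G`-bounded on `[−1,1]`) the increments `|∫g_K dλ_{K+1} − ∫g_K dλ_K|` are summable (dominated by `48(K_g+G)∕(1 + log⁺ r_K⁻¹)`). [folklore] -/
theorem summable_lawIncrements_of_uniformMoments {Λ : ℕ → Measure ℝ} [hP : ∀ K, IsProbabilityMeasure (Λ K)]
    (hΛ : ∀ K, Λ K (Set.Icc (-1 : ℝ) 1)ᶜ = 0) {r : ℕ → ℝ}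
    (hmom : ∀ K j : ℕ, |∫ x, x ^ j ∂Λ (K + 1) - ∫ x, x ^ j ∂Λ K| ≤ r K)
    (hS : Summable fun K => 1 / (1 + Real.posLog (r K)⁻¹))
    {g : ℕ → ℝ → ℝ} (hg : ∀ K, Continuous (g K)) {Kg G : ℝ} (hK0 : 0 ≤ Kg)
    (hK : ∀ (K : ℕ) (x y : ℝ), x ∈ Set.Icc (-1 : ℝ) 1 → y ∈ Set.Icc (-1 : ℝ) 1 → |g K x - g K y| ≤ Kg * |x - y|)
    (hG : ∀ (K : ℕ) (x : ℝ), x ∈ Set.Icc (-1 : ℝ) 1 → |g K x| ≤ G) :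
    Summable fun K => |∫ x, g K x ∂Λ (K + 1) - ∫ x, g K x ∂Λ K| := by
  refine Summable.of_nonneg_of_le (fun K => abs_nonneg _) (fun K => ?_) (hS.mul_left (48 * (Kg + G)))
  calc |∫ x, g K x ∂Λ (K + 1) - ∫ x, g K x ∂Λ K| ≤ 48 * (Kg + G) / (1 + Real.posLog (r K)⁻¹) :=
        lawIncrement_le_of_uniformMoments (hΛ K) (hΛ (K + 1)) (hmom K) (hg K) hK0 (hK K) (hG K)
    _ = 48 * (Kg + G) * (1 / (1 + Real.posLog (r K)⁻¹)) := by ring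

end Laws

/-! ## §2 One base for every level: the complementary Chebyshev-arc laws, and their half-scale transport [folklore] -/

/-- ★ **THE COMPLEMENTARY CHEBYSHEV-ARC LAWS WITH THEIR TWO STRUCTURAL IDENTITIES** (module 72's construction, re-packaged so that the alternating arc
functional and the tiling identity are exported): for `n ≥ 3`, probability laws `P, Q` on `[−1,1]` (Lebesgue measure on the even ∕ odd arcs between the
Chebyshev extrema `cos(kπ∕n)`) with `∫f dP − ∫f dQ = Σ_{k<n} (−1)^k ∫_{x_{k+1}}^{x_k} f` and `∫f dP + ∫f dQ = ∫_{−1}^{1} f` for every continuous `f`, and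
module 72's test polynomial: continuous, `1`-Lipschitz and `1∕(2n)`-bounded on `[−1,1]`, paid `∫g dP − ∫g dQ = 1∕(2n)` EXACTLY. [folklore] -/
theorem exists_chebyshevArc_laws_alt {n : ℕ} (hn : 3 ≤ n) :
    ∃ P Q : Measure ℝ, IsProbabilityMeasure P ∧ IsProbabilityMeasure Q ∧
      P (Set.Icc (-1 : ℝ) 1)ᶜ = 0 ∧ Q (Set.Icc (-1 : ℝ) 1)ᶜ = 0 ∧
      (∀ f : ℝ → ℝ, Continuous f →
        ∫ x, f x ∂P - ∫ x, f x ∂Q = ∑ k ∈ range n, (-1 : ℝ) ^ k * ∫ x in node n (k + 1)..node n k, f x) ∧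
      (∀ f : ℝ → ℝ, Continuous f → ∫ x, f x ∂P + ∫ x, f x ∂Q = ∫ x in (-1 : ℝ)..1, f x) ∧
      ∃ g : ℝ → ℝ, Continuous g ∧
        (∀ x y : ℝ, x ∈ Set.Icc (-1 : ℝ) 1 → y ∈ Set.Icc (-1 : ℝ) 1 → |g x - g y| ≤ 1 * |x - y|) ∧
        (∀ x : ℝ, x ∈ Set.Icc (-1 : ℝ) 1 → |g x| ≤ 1 / (2 * n)) ∧
        ∫ x, g x ∂P - ∫ x, g x ∂Q = 1 / (2 * n) := by
  classical
  have hn0 : n ≠ 0 := by omega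
  have hE : (range n).filter (fun k => Even k) ⊆ range n := Finset.filter_subset _ _
  have hO : (range n).filter (fun k => ¬ Even k) ⊆ range n := Finset.filter_subset _ _
  set P : Measure ℝ := ∑ k ∈ (range n).filter (fun k => Even k),
    (volume : Measure ℝ).restrict (Set.Ioc (node n (k + 1)) (node n k)) with hP
  set Q : Measure ℝ := ∑ k ∈ (range n).filter (fun k => ¬ Even k),
    (volume : Measure ℝ).restrict (Set.Ioc (node n (k + 1)) (node n k)) with hQ
  obtain ⟨hEsum, hOsum⟩ := sum_arcLength_even_odd (n := n) (by omega)
  have iP : IsProbabilityMeasure P := ⟨by rw [hP, arcMeasure_apply_univ n hE, hEsum, ENNReal.ofReal_one]⟩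
  have iQ : IsProbabilityMeasure Q := ⟨by rw [hQ, arcMeasure_apply_univ n hO, hOsum, ENNReal.ofReal_one]⟩
  have hsub : ∀ {f : ℝ → ℝ}, Continuous f →
      ∫ x, f x ∂P - ∫ x, f x ∂Q = ∑ k ∈ range n, (-1 : ℝ) ^ k * ∫ x in node n (k + 1)..node n k, f x :=
    fun hf => by rw [hP, hQ, integral_arcMeasure n hE hf, integral_arcMeasure n hO hf, alt_sum_eq_even_sub_odd]
  have hadd : ∀ {f : ℝ → ℝ}, Continuous f → ∫ x, f x ∂P + ∫ x, f x ∂Q = ∫ x in (-1 : ℝ)..1, f x := fun hf => by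
    rw [hP, hQ, integral_arcMeasure n hE hf, integral_arcMeasure n hO hf, Finset.sum_filter_add_sum_filter_not,
      sum_integral_arcs hn0 hf]
  refine ⟨P, Q, iP, iQ, by rw [hP]; exact arcMeasure_Icc_compl n _, by rw [hQ]; exact arcMeasure_Icc_compl n _,
    fun f hf => hsub hf, fun f hf => hadd hf,
    fun x => ((T ℝ ((n : ℤ) - 1)).eval x - (T ℝ ((n : ℤ) + 1)).eval x) / (4 * n),
    ((Polynomial.continuous _).sub (Polynomial.continuous _)).div_const _,
    (testPoly_lipschitz_bound (by omega)).1, (testPoly_lipschitz_bound (by omega)).2, ?_⟩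
  rw [hsub (f := fun x => ((T ℝ ((n : ℤ) - 1)).eval x - (T ℝ ((n : ℤ) + 1)).eval x) / (4 * n))
    (by exact ((Polynomial.continuous _).sub (Polynomial.continuous _)).div_const _)]
  exact alt_sum_integral_testPoly hn

/-- ★★ **THE ARC LAWS AT HALF SCALE: ALL MOMENTS WITHIN `2(½)^n` OF ONE BASE SEQUENCE.**  For `n ≥ 3` there are probability laws `P', Q'` on `[−1,1]`
(the images of `exists_chebyshevArc_laws_alt`'s laws under `x ↦ x∕2`, carried by `[−½,½]`) such that: (i) every moment of order `j ≤ n−2` of either law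
EQUALS `β_j = ½∫_{−1}^{1}(x∕2)^j dx`; (ii) EVERY moment of either law is within `2(½)^n` of `β_j`; (iii) a continuous `g`, `1`-Lipschitz and
`1∕(4n)`-bounded on `[−1,1]`, is paid `∫g dP' − ∫g dQ' = 1∕(4n)` EXACTLY.  The base `β` does not depend on `n`: this is the common-base family the
uniform-moment currency needs. [folklore] -/
theorem exists_halfScale_chebyshevArc_laws {n : ℕ} (hn : 3 ≤ n) :
    ∃ P Q : Measure ℝ, IsProbabilityMeasure P ∧ IsProbabilityMeasure Q ∧
      P (Set.Icc (-1 : ℝ) 1)ᶜ = 0 ∧ Q (Set.Icc (-1 : ℝ) 1)ᶜ = 0 ∧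
      (∀ j : ℕ, j + 2 ≤ n → ∫ x, x ^ j ∂P = 1 / 2 * ∫ x in (-1 : ℝ)..1, (x / 2) ^ j ∧
        ∫ x, x ^ j ∂Q = 1 / 2 * ∫ x in (-1 : ℝ)..1, (x / 2) ^ j) ∧
      (∀ j : ℕ, |∫ x, x ^ j ∂P - 1 / 2 * ∫ x in (-1 : ℝ)..1, (x / 2) ^ j| ≤ 2 * (1 / 2 : ℝ) ^ n ∧
        |∫ x, x ^ j ∂Q - 1 / 2 * ∫ x in (-1 : ℝ)..1, (x / 2) ^ j| ≤ 2 * (1 / 2 : ℝ) ^ n) ∧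
      ∃ g : ℝ → ℝ, Continuous g ∧
        (∀ x y : ℝ, x ∈ Set.Icc (-1 : ℝ) 1 → y ∈ Set.Icc (-1 : ℝ) 1 → |g x - g y| ≤ 1 * |x - y|) ∧
        (∀ x : ℝ, x ∈ Set.Icc (-1 : ℝ) 1 → |g x| ≤ 1 / (4 * n)) ∧
        ∫ x, g x ∂P - ∫ x, g x ∂Q = 1 / (4 * n) := by
  obtain ⟨P₀, Q₀, iP, iQ, hP₀c, hQ₀c, hsub, hadd, g, hgc, hgL, hgB, hpay⟩ := exists_chebyshevArc_laws_alt hn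
  have hn0 : n ≠ 0 := by omega
  have hnr : (0 : ℝ) < n := by exact_mod_cast Nat.pos_of_ne_zero hn0
  have hmeas : Measurable fun x : ℝ => x / 2 := by fun_prop
  have iP' : IsProbabilityMeasure (P₀.map fun x : ℝ => x / 2) := Measure.isProbabilityMeasure_map hmeas.aemeasurable
  have iQ' : IsProbabilityMeasure (Q₀.map fun x : ℝ => x / 2) := Measure.isProbabilityMeasure_map hmeas.aemeasurable
  have hsupp : ∀ {κ : Measure ℝ}, κ (Set.Icc (-1 : ℝ) 1)ᶜ = 0 → (κ.map fun x : ℝ => x / 2) (Set.Icc (-1 : ℝ) 1)ᶜ = 0 := by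
    intro κ hκ
    rw [Measure.map_apply hmeas measurableSet_Icc.compl]
    refine measure_mono_null (fun x hx => ?_) hκ
    simp only [Set.preimage_compl, Set.mem_compl_iff, Set.mem_preimage, Set.mem_Icc, not_and_or, not_le] at hx ⊢
    rcases hx with h | h
    · left; linarith
    · right; linarith
  have hint : ∀ (κ : Measure ℝ) {f : ℝ → ℝ}, Continuous f → ∫ y, f y ∂(κ.map fun x : ℝ => x / 2) = ∫ x, f (x / 2) ∂κ :=
    fun κ f hf => integral_map hmeas.aemeasurable hf.aestronglyMeasurable
  -- the arc integrals of `(x∕2)^j`: each at most `(½)^j·(arc length)`; their alternating sum vanishes for `j + 2 ≤ n`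
  have hcont : ∀ j : ℕ, Continuous fun x : ℝ => (x / 2) ^ j := fun j => by fun_prop
  have hterm : ∀ j k : ℕ, k ∈ range n →
      |(-1 : ℝ) ^ k * ∫ x in node n (k + 1)..node n k, (x / 2) ^ j| ≤ (1 / 2 : ℝ) ^ j * (node n k - node n (k + 1)) := by
    intro j k hk
    rw [abs_mul, abs_pow, abs_neg, abs_one, one_pow, one_mul]
    have hlt := node_succ_lt (Finset.mem_range.1 hk)
    have h := intervalIntegral.norm_integral_le_of_norm_le_const (a := node n (k + 1)) (b := node n k)
      (C := (1 / 2 : ℝ) ^ j) (f := fun x : ℝ => (x / 2) ^ j) (fun x hx => by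
        rw [Set.uIoc_of_le hlt.le] at hx
        rw [Real.norm_eq_abs, abs_pow, abs_div, abs_two]
        have h1 : |x| ≤ 1 :=
          abs_le.2 ⟨(node_mem_Icc (n := n) (i := k + 1)).1.trans hx.1.le, hx.2.trans (node_mem_Icc (n := n) (i := k)).2⟩
        exact pow_le_pow_left₀ (by positivity) (by linarith) j)
    rw [Real.norm_eq_abs, abs_of_pos (sub_pos.2 hlt)] at h
    exact h
  have halt_abs : ∀ j : ℕ,
      |∑ k ∈ range n, (-1 : ℝ) ^ k * ∫ x in node n (k + 1)..node n k, (x / 2) ^ j| ≤ 2 * (1 / 2 : ℝ) ^ j := fun j =>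
    calc |∑ k ∈ range n, (-1 : ℝ) ^ k * ∫ x in node n (k + 1)..node n k, (x / 2) ^ j|
        ≤ ∑ k ∈ range n, |(-1 : ℝ) ^ k * ∫ x in node n (k + 1)..node n k, (x / 2) ^ j| := Finset.abs_sum_le_sum_abs _ _
      _ ≤ ∑ k ∈ range n, (1 / 2 : ℝ) ^ j * (node n k - node n (k + 1)) := Finset.sum_le_sum (hterm j)
      _ = 2 * (1 / 2 : ℝ) ^ j := by rw [← Finset.mul_sum, sum_arcLength hn0]; ring
  have halt_zero : ∀ j : ℕ, j + 2 ≤ n →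
      ∑ k ∈ range n, (-1 : ℝ) ^ k * ∫ x in node n (k + 1)..node n k, (x / 2) ^ j = 0 := by
    intro j hj
    have h := alt_sum_integral_pow_eq_zero (n := n) (j := j) hj
    have e : ∀ k : ℕ, (-1 : ℝ) ^ k * ∫ x in node n (k + 1)..node n k, (x / 2) ^ j =
        (1 / 2 : ℝ) ^ j * ((-1 : ℝ) ^ k * ∫ x in node n (k + 1)..node n k, x ^ j) := by
      intro k
      rw [show (∫ x in node n (k + 1)..node n k, (x / 2) ^ j) = (1 / 2 : ℝ) ^ j * ∫ x in node n (k + 1)..node n k, x ^ j by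
        rw [← intervalIntegral.integral_const_mul]
        exact intervalIntegral.integral_congr fun x _ => by ring]
      ring
    simp_rw [e]
    rw [← Finset.mul_sum, h, mul_zero]
  have hPj : ∀ j : ℕ, ∫ y, y ^ j ∂(P₀.map fun x : ℝ => x / 2) - 1 / 2 * ∫ x in (-1 : ℝ)..1, (x / 2) ^ j =
      1 / 2 * ∑ k ∈ range n, (-1 : ℝ) ^ k * ∫ x in node n (k + 1)..node n k, (x / 2) ^ j := fun j => by
    have h1 := hsub _ (hcont j)
    have h2 := hadd _ (hcont j)
    rw [hint P₀ (continuous_pow j)]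
    linarith
  have hQj : ∀ j : ℕ, ∫ y, y ^ j ∂(Q₀.map fun x : ℝ => x / 2) - 1 / 2 * ∫ x in (-1 : ℝ)..1, (x / 2) ^ j =
      -(1 / 2 * ∑ k ∈ range n, (-1 : ℝ) ^ k * ∫ x in node n (k + 1)..node n k, (x / 2) ^ j) := fun j => by
    have h1 := hsub _ (hcont j)
    have h2 := hadd _ (hcont j)
    rw [hint Q₀ (continuous_pow j)]
    linarith
  have habs_half : ∀ j : ℕ,
      |1 / 2 * ∑ k ∈ range n, (-1 : ℝ) ^ k * ∫ x in node n (k + 1)..node n k, (x / 2) ^ j| ≤ 2 * (1 / 2 : ℝ) ^ n := by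
    intro j
    by_cases hj : j + 2 ≤ n
    · rw [halt_zero j hj, mul_zero, abs_zero]; positivity
    · have hjn : n ≤ j + 1 := by omega
      have hpow : (1 / 2 : ℝ) ^ j ≤ 2 * (1 / 2 : ℝ) ^ n := by
        have h : (1 / 2 : ℝ) ^ (j + 1) ≤ (1 / 2 : ℝ) ^ n := pow_le_pow_of_le_one (by norm_num) (by norm_num) hjn
        rw [pow_succ] at h
        linarith
      rw [abs_mul, abs_of_pos (by norm_num : (0 : ℝ) < 1 / 2)]
      calc 1 / 2 * |∑ k ∈ range n, (-1 : ℝ) ^ k * ∫ x in node n (k + 1)..node n k, (x / 2) ^ j|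
          ≤ 1 / 2 * (2 * (1 / 2 : ℝ) ^ j) := mul_le_mul_of_nonneg_left (halt_abs j) (by norm_num)
        _ = (1 / 2 : ℝ) ^ j := by ring
        _ ≤ 2 * (1 / 2 : ℝ) ^ n := hpow
  -- the clamp `c` and the pulled-back test `y ↦ g(c(2y))∕2`
  set c : ℝ → ℝ := fun t => max (min t 1) (-1) with hcdef
  have hc_mem : ∀ t, c t ∈ Set.Icc (-1 : ℝ) 1 := fun t => ⟨le_max_right _ _, max_le (min_le_right _ _) (by norm_num)⟩
  have hc_id : ∀ t ∈ Set.Icc (-1 : ℝ) 1, c t = t := fun t ht => by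
    simp only [hcdef, min_eq_left ht.2, max_eq_left ht.1]
  have hc_lip : ∀ a b : ℝ, |c a - c b| ≤ |a - b| := fun a b =>
    calc |c a - c b| ≤ |min a 1 - min b 1| := abs_max_sub_max_le_abs _ _ _
      _ ≤ max |a - b| |(1 : ℝ) - 1| := abs_min_sub_min_le_max _ _ _ _
      _ = |a - b| := by rw [sub_self, abs_zero, max_eq_left (abs_nonneg _)]
  have hc_cont : Continuous c := (continuous_id.min continuous_const).max continuous_const
  have hg'c : Continuous fun y : ℝ => g (c (2 * y)) / 2 :=
    (hgc.comp (hc_cont.comp (continuous_const.mul continuous_id))).div_const _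
  -- the test integrals transport back to `½∫g` (the laws live on `[−1,1]`, where the clamp is the identity)
  have hae : ∀ (κ : Measure ℝ), κ (Set.Icc (-1 : ℝ) 1)ᶜ = 0 →
      ∫ x, g (c (2 * (x / 2))) / 2 ∂κ = 1 / 2 * ∫ x, g x ∂κ := by
    intro κ hκ
    rw [← integral_const_mul]
    refine integral_congr_ae ?_
    have h : ∀ᵐ x ∂κ, x ∈ Set.Icc (-1 : ℝ) 1 := by
      rw [ae_iff]
      simpa only [Set.mem_Icc, Set.compl_def] using hκ
    exact h.mono fun x hx => by
      show g (c (2 * (x / 2))) / 2 = 1 / 2 * g x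
      rw [show 2 * (x / 2) = x by ring, hc_id x hx]
      ring
  refine ⟨P₀.map (fun x : ℝ => x / 2), Q₀.map (fun x : ℝ => x / 2), iP', iQ', hsupp hP₀c, hsupp hQ₀c,
    fun j hj => ⟨?_, ?_⟩, fun j => ⟨?_, ?_⟩, fun y => g (c (2 * y)) / 2, hg'c, ?_, ?_, ?_⟩
  · have h := hPj j
    rw [halt_zero j hj, mul_zero, sub_eq_zero] at h
    exact h
  · have h := hQj j
    rw [halt_zero j hj, mul_zero, neg_zero, sub_eq_zero] at h
    exact h
  · rw [hPj j]; exact habs_half j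
  · rw [hQj j, abs_neg]; exact habs_half j
  · intro x y _ _
    have h1 := hgL (c (2 * x)) (c (2 * y)) (hc_mem _) (hc_mem _)
    have h2 := hc_lip (2 * x) (2 * y)
    rw [show 2 * x - 2 * y = 2 * (x - y) by ring, abs_mul, abs_two] at h2
    rw [show g (c (2 * x)) / 2 - g (c (2 * y)) / 2 = (g (c (2 * x)) - g (c (2 * y))) / 2 by ring, abs_div, abs_two]
    linarith
  · intro x _
    have h := hgB (c (2 * x)) (hc_mem _)
    rw [abs_div, abs_two, show 1 / (4 * (n : ℝ)) = (1 / (2 * n)) / 2 by field_simp; ring]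
    linarith
  · rw [hint P₀ hg'c, hint Q₀ hg'c, hae P₀ hP₀c, hae Q₀ hQ₀c, ← mul_sub, hpay]
    field_simp
    ring

/-! ## §3 At the torus scheme: uniform matching loses the window's `log log` [bookkeeping] -/

section Scheme

variable {G : Type*} [GaugeGroup G] [MeasurableSpace G] [RegularGaugeGroup G] [HaarData G] {O : Type*}
  (S : TorusScheme G O) (hβ : ∀ K, 0 ≤ S.β K) (hm : ∀ K o, Measurable (S.obs K o)) (h1 : ∀ K o U, |S.obs K o U| ≤ 1)
include hβ hm h1

/-- **THE MOMENTS OF ONE STRING MOVE UNIFORMLY IN THE ORDER** [bookkeeping]: if the dressed partition functions of EVERY power `os^k` of a string (the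
`k`-fold concatenation, `(List.replicate k os).flatten`) match modulo constants with remainder `δ` at radius `l₀ > 0`, then for every `K` and every `k`
`|∫(∏os)^k dgibbs_{K+1} − ∫(∏os)^k dgibbs_K| ≤ (8e^{1+l₀}∕l₀)·vol·δ_K·(1 + log⁺(2vol·δ_K)⁻¹)` — p481156's one-step price for the string `os^k`, whose
observable is `(∏os)^k` (`prodObs_replicate_flatten`). -/
theorem uniformMoments_step_of_matchingModConstants_pow {vol l₀ : ℝ} {δ : ℕ → ℝ} (hl₀ : 0 < l₀) (os : List O)
    (hM : ∀ k : ℕ, MatchingModConstants vol l₀ δ (schemeZ S (List.replicate k os).flatten)) (K k : ℕ) :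
    |∫ U, prodObs S (K + 1) os U ^ k ∂gibbsMeasure (S.P (K + 1)) (S.β (K + 1)) -
        ∫ U, prodObs S K os U ^ k ∂gibbsMeasure (S.P K) (S.β K)| ≤
      8 * Real.exp (1 + l₀) / l₀ * (vol * δ K) * (1 + Real.posLog (2 * (vol * δ K))⁻¹) := by
  have hE : ∀ K, ∫ U, prodObs S K os U ^ k ∂gibbsMeasure (S.P K) (S.β K) = S.expectAt K (List.replicate k os).flatten := fun K => by
    rw [T4GenFunBounds.expectAt_eq_integral_gibbs S hβ K]; exact integral_congr_ae (ae_of_all _ fun U => (prodObs_replicate_flatten S K os k U).symm)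
  rw [hE, hE]
  exact abs_expectAt_succ_sub_le_linlog_of_matchingModConstants S hβ hm h1 hl₀ _ (hM k) K

/-- ★ **SUMMABLE LAW INCREMENTS AT THE SCHEME UNDER UNIFORM MATCHING** [bookkeeping]: with `r_K = (8e^{1+l₀}∕l₀)·vol·δ_K·(1 + log⁺(2vol·δ_K)⁻¹)`,
IF `Σ_K 1∕(1 + log⁺ r_K⁻¹) < ∞` and every power of the string matches modulo constants (`0 < l₀`), THEN the increments of `K ↦ ∫g_K(∏os) dgibbs_K` are
summable along every sequence of continuous tests, uniformly `K_g`-Lipschitz and `G_g`-bounded on `[−1,1]` (§1 at the laws of `∏os`, module 64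
`law_prodObs_Icc_compl`).  No `log log`: contrast module 74 `summable_lawIncrements_of_target` (ONE string's window). -/
theorem summable_lawIncrements_of_matchingModConstants_pow {vol l₀ : ℝ} {δ : ℕ → ℝ} (hl₀ : 0 < l₀) (os : List O)
    (hM : ∀ k : ℕ, MatchingModConstants vol l₀ δ (schemeZ S (List.replicate k os).flatten))
    (hS : Summable fun K =>
      1 / (1 + Real.posLog (8 * Real.exp (1 + l₀) / l₀ * (vol * δ K) * (1 + Real.posLog (2 * (vol * δ K))⁻¹))⁻¹))
    {g : ℕ → ℝ → ℝ} (hg : ∀ K, Continuous (g K)) {Kg Gg : ℝ} (hK0 : 0 ≤ Kg)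
    (hK : ∀ (K : ℕ) (x y : ℝ), x ∈ Set.Icc (-1 : ℝ) 1 → y ∈ Set.Icc (-1 : ℝ) 1 → |g K x - g K y| ≤ Kg * |x - y|)
    (hG : ∀ (K : ℕ) (x : ℝ), x ∈ Set.Icc (-1 : ℝ) 1 → |g K x| ≤ Gg) :
    Summable fun K => |∫ U, g K (prodObs S (K + 1) os U) ∂gibbsMeasure (S.P (K + 1)) (S.β (K + 1)) -
      ∫ U, g K (prodObs S K os U) ∂gibbsMeasure (S.P K) (S.β K)| := by
  haveI hP : ∀ K, IsProbabilityMeasure (gibbsMeasure (G := G) (S.P K) (S.β K)) := fun K =>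
    T4GenFunBounds.isProbabilityMeasure_gibbsMeasure (G := G) (S.P K) (hβ K)
  have hmeas : ∀ K, AEMeasurable (prodObs S K os) (gibbsMeasure (S.P K) (S.β K)) := fun K =>
    (T4GenFunBounds.measurable_prodObs S hm K os).aemeasurable
  haveI : ∀ K, IsProbabilityMeasure ((gibbsMeasure (S.P K) (S.β K)).map (prodObs S K os)) := fun K =>
    Measure.isProbabilityMeasure_map (hmeas K)
  have hint : ∀ (K : ℕ) {f : ℝ → ℝ}, Continuous f →
      ∫ x, f x ∂((gibbsMeasure (S.P K) (S.β K)).map (prodObs S K os)) = ∫ U, f (prodObs S K os U) ∂gibbsMeasure (S.P K) (S.β K) :=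
    fun K f hf => integral_map (hmeas K) hf.aestronglyMeasurable
  have hmom : ∀ K j : ℕ, |∫ x, x ^ j ∂((gibbsMeasure (S.P (K + 1)) (S.β (K + 1))).map (prodObs S (K + 1) os)) -
      ∫ x, x ^ j ∂((gibbsMeasure (S.P K) (S.β K)).map (prodObs S K os))| ≤
      8 * Real.exp (1 + l₀) / l₀ * (vol * δ K) * (1 + Real.posLog (2 * (vol * δ K))⁻¹) := fun K j => by
    rw [hint (K + 1) (continuous_pow j), hint K (continuous_pow j)]
    exact uniformMoments_step_of_matchingModConstants_pow S hβ hm h1 hl₀ os hM K j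
  have h := summable_lawIncrements_of_uniformMoments (Λ := fun K => (gibbsMeasure (S.P K) (S.β K)).map (prodObs S K os))
    (fun K => law_prodObs_Icc_compl S hm h1 K os) hmom hS hg hK0 hK hG
  refine h.congr fun K => ?_
  rw [hint (K + 1) (hg K), hint K (hg K)]

/-- ★ **UNDER UNIFORM `Target`** [bookkeeping]: the same conclusion from `∀ os', Spine.NE7.Target vol l₀ δ (schemeZ S os')` (N19's DECL target for
every string — the lineage's «uniform Target», a HYPOTHESIS) and `Σ_K 1∕(1 + log⁺ r_K⁻¹) < ∞`. -/
theorem summable_lawIncrements_of_uniformTarget {vol l₀ : ℝ} {δ : ℕ → ℝ} (hl₀ : 0 < l₀)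
    (hT : ∀ os' : List O, NE7.Target vol l₀ δ (schemeZ S os')) (os : List O)
    (hS : Summable fun K =>
      1 / (1 + Real.posLog (8 * Real.exp (1 + l₀) / l₀ * (vol * δ K) * (1 + Real.posLog (2 * (vol * δ K))⁻¹))⁻¹))
    {g : ℕ → ℝ → ℝ} (hg : ∀ K, Continuous (g K)) {Kg Gg : ℝ} (hK0 : 0 ≤ Kg)
    (hK : ∀ (K : ℕ) (x y : ℝ), x ∈ Set.Icc (-1 : ℝ) 1 → y ∈ Set.Icc (-1 : ℝ) 1 → |g K x - g K y| ≤ Kg * |x - y|)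
    (hG : ∀ (K : ℕ) (x : ℝ), x ∈ Set.Icc (-1 : ℝ) 1 → |g K x| ≤ Gg) :
    Summable fun K => |∫ U, g K (prodObs S (K + 1) os U) ∂gibbsMeasure (S.P (K + 1)) (S.β (K + 1)) -
      ∫ U, g K (prodObs S K os U) ∂gibbsMeasure (S.P K) (S.β K)| :=
  summable_lawIncrements_of_matchingModConstants_pow S hβ hm h1 hl₀ os (fun _ => (hT _).1) hS hg hK0 hK hG

end Scheme

end Summit.QuantumFields.YangMills.Theorems.BalabanUVNodesN19UniformMomentSummabilityThreshold

end
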